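import Summits.ResolutionOfSingularities.ResolutionOfSingularities.Theorems.HilbertSamuelEliminationSigmaMaxModificationsCorridor3SigmaStrataRowsDefs
import Summits.ResolutionOfSingularities.ResolutionOfSingularities.Theorems.HilbertSamuelEliminationSigmaMaxModificationsCorridor3SigmaStrataLabels
import Summits.ResolutionOfSingularities.ResolutionOfSingularities.Theorems.HilbertSamuelEliminationSigmaMaxModificationsCorridor3SigmaStrataParts
import HarnessLib

/-!
# [OURS · L1 W4.2] σ-LAYER — Ω-TRANSPORT brick 3b: the W-low STRATA-HALF over Ω⁺ ASSEMBLED FROM ITS KERNEL ROWS —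
# (b)Ω⁺ ⟸ (c-rep) ∧ (b-end); (c)Ω⁺ ⟸ (c-geo) ∧ (c-rep) by LINEAGE TRACKING THROUGH Ω⁺-CYCLES; hence «no moving never-isolated chain»

Crux chain w42 (`SigmaMaxModifications`, stmt-ResolutionOfSingularities-18506; conjunct `SigmaMaxModificationsCorridor3`,
stmt-ResolutionOfSingularities-19249), res-L1-w42-plan-1 RULING v3.14-12 (BR-6) / v3.14-14 (DL) «Ω-transports of the W-low rows — 040».
Typer res-type-040 (gen 18). Ports of stub-4's `strataBirthsSettle_of_replaySettle_of_cycleEnd` (p505133) and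
`strataLineagesFinite_of_centreIO_of_replaySettle` (p503885) to the END-rule variant Ω⁺ (`σ = Strategy.ofStageOraclePlus ω`, `ω` a FUNCTIONAL,
Ω⁺-ADMISSIBLE stage oracle), and the assembly `maxOriginNoMovingNearChainAtQσ_notIso_of_kernels_Ωplus` through brick 1's Kőnig reduction.
OURS (cell res-hironaka, slot W4.2); NOT statements of H. Hironaka's manuscript [Hironaka2017] nor of [CossartJannsenSaito2020]; AI-written,
weaker than expert review. Every `theorem` is PROVED; this file is def-free. Helper file `--supports stmt-ResolutionOfSingularities-19249`.

## What changes under Ω⁺ (and how it is repaired)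

stub-4's proof of (c) ⟸ (c-geo) ∧ (c-rep) ends with «a label-`j` component through `x_m` lies in the cycle-END centre, which is the whole
part `Y_m^{(j)}`» (`support_eq_part_of_next_none`). Under Ω⁺ the END centre is only `V(range φ) ⊆ Y_m^{(j)}` (brick 2b): a label-`j`
component may have escaped the replayed subscheme by being dominated after an ancestor was SWALLOWED by an in-cycle centre. The repair is
to TRACK THE LINEAGE THROUGH THE CYCLE (`lineage_in_centre_or_subset_cycleRange_Ωplus`): from a state between cycles on, a dominating
label-`j` lineage either lies inside some centre of the cycle (an ancestor was swallowed — then the lineage IS in a centre, which is what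
(c-geo) forbids infinitely often), or stays inside the cycle range (`cycleRange`, brick 3a): the next member lies in the strict transform of
the previous one (`subset_strictTransformSet_of_closure_image_eq`), and the next cycle range IS the strict transform of the previous one
(`StepProjectionσ.exists_range_hom_eq_strictTransformSet_Ωplus`, GW 13.96 (2)); at the blown-up END step the centre is `V(cycleRange)`
(`support_eq_cycleRange_of_next_none_Ωplus`). Either way the lineage meets a centre in every late cycle in which the chain point is blown up.

Contents (namespace `…Theorems.SigmaMaxModificationsCorridor3.Sigma`): `strataBirthsSettleσ_of_replaySettle_of_cycleEnd_Ωplus`,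
`StepProjectionσ.exists_range_hom_eq_strictTransformSet_Ωplus`, `support_eq_cycleRange_of_next_none_Ωplus`,
`subset_strictTransformSet_of_closure_image_eq`, `lineage_in_centre_or_subset_cycleRange_Ωplus`,
`strataLineagesFiniteσ_of_centreIO_of_replaySettle_Ωplus`, `maxOriginNoMovingNearChainAtQσ_notIso_of_kernels_Ωplus`,
`maxOriginNoMovingNearChainAtQσ_of_kernels_Ωplus`. References: CJS LNM 2270 Rem. 6.29 (1) pp. 91–92, p. 105 [CossartJannsenSaito2020];
Görtz–Wedhorn I (13.19), Prop. 13.96 (2) [GortzWedhorn2020]; tree p503885, p505133, p526259 (brick 1), brick 2 `…SigmaStrataLabels`,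
brick 2b `…SigmaStrataParts`, brick 3a `…SigmaStrataRowsDefs`.
-/

noncomputable section

set_option linter.dupNamespace false

open CategoryTheory AlgebraicGeometry TopologicalSpace Topology
open Summit.ResolutionOfSingularities.ResolutionOfSingularities.Theorems.CampaignW42
open Literature.AlgebraicGeometry.Resolution Literature.RingTheory.HilbertSamuel
open Summit.ResolutionOfSingularities.ResolutionOfSingularities.Theorems.SigmaMaxModificationsCorridor3
open Summit.ResolutionOfSingularities.ResolutionOfSingularities.Theorems.SigmaMaxModificationsCorridor3.Moving

namespace Summit.ResolutionOfSingularities.ResolutionOfSingularities.Theorems.SigmaMaxModificationsCorridor3.Sigma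

universe u

/-! ## §1. A pure lemma: a dominating set lies in the strict transform of its image -/

/-- **A (pre)irreducible `Z'` DOMINATING `Z ⊄ D` lies in the strict transform of `Z`**: `closure f(Z') = Z`, `D` closed, `Z ⊄ D` ⟹
`Z' ⊆ closure f⁻¹(Z ∖ D)` (the trace of `Z'` off `f⁻¹ D` is a non-empty open of `Z'`, hence dense). [cite: GortzWedhorn2020, (13.19) p. 414] -/
theorem subset_strictTransformSet_of_closure_image_eq {X X' : Scheme.{u}} (f : X' ⟶ X) {D Z : Set X} (hD : IsClosed D)
    {Z' : Set X'} (hZ' : IsPreirreducible Z') (hdom : closure (f.base '' Z') = Z) (hZD : ¬ Z ⊆ D) :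
    Z' ⊆ strictTransformSet f D Z := by
  have hfZ : f.base '' Z' ⊆ Z := hdom ▸ subset_closure
  have hne : (Z' ∩ (f.base ⁻¹' D)ᶜ).Nonempty := by
    rw [← Set.sdiff_eq, Set.nonempty_iff_ne_empty, Ne, Set.sdiff_eq_empty]
    intro h
    apply hZD
    rw [← hdom]
    exact closure_minimal (Set.image_subset_iff.mpr h) hD
  have h1 : Z' ⊆ closure (Z' ∩ (f.base ⁻¹' D)ᶜ) :=
    subset_closure_inter_of_isPreirreducible_of_isOpen hZ' (hD.preimage f.continuous).isOpen_compl hne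
  refine h1.trans (closure_mono ?_)
  rintro w ⟨hwZ, hwD⟩
  exact ⟨hfZ ⟨w, hwZ, rfl⟩, hwD⟩

section Omega

variable {ω : StageOracle.{u}} {N : ℕ} {ν : ℕ → ℕ} {s s' : MarkedStage.{u}}

/-! ## §2. Row (b)Ω⁺ from (c-rep) and (b-end) -/

/-- **ROW (b)σ FROM (c-rep)σ AND (b-end)σ over Ω⁺, under `ν ≠ Φ^{(N)}` — PROVED** (port of stub-4's
`strataBirthsSettle_of_replaySettle_of_cycleEnd`): a newborn component through `x_{n+1}` forces a blown-up stage
(`isBlownUpσ_of_birth_Ωplus`, brick 2b), which (c-rep) makes a cycle end, where (b-end) forbids births. [cite: CossartJannsenSaito2020, Rem. 6.29 (1), p. 92] -/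
theorem strataBirthsSettleσ_of_replaySettle_of_cycleEnd_Ωplus {p : ℕ} {Q : ℕ → (ℕ → ℕ) → ∀ X : Scheme.{u}, X → Prop}
    {G : MarkedStage.{u} → Prop} (hω : OracleAdmissibleΩplus ω)
    (hrep : StrataReplayBlowupsSettleσ (Strategy.ofStageOraclePlus ω) p N (QNe Q) G)
    (hend : StrataCycleEndBirthsSettleσ (Strategy.ofStageOraclePlus ω) p N (QNe Q) G) :
    StrataBirthsSettleσ (Strategy.ofStageOraclePlus ω) p N (QNe Q) G := by
  intro ν X _ x hX hQ c h0 hstep hG hnI hmov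
  have hν : ν ≠ iterPSum N Phi := hQ.2
  obtain ⟨k, _, hinv⟩ := exists_cycleInvPlus_chain hω hν hX h0 hstep
  obtain ⟨n₁, hn₁⟩ := hrep ν X x hX hQ c h0 hstep hG hnI hmov
  obtain ⟨n₂, hn₂⟩ := hend ν X x hX hQ c h0 hstep hG hnI hmov
  refine ⟨max n₁ n₂, fun n hn f hf Z' hZ' => ?_⟩
  by_contra hnot
  have hbu : (c n).IsBlownUpσ (Strategy.ofStageOraclePlus ω) N ν := isBlownUpσ_of_birth_Ωplus hω hν (hinv n) hf hZ' hnot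
  exact hnot (hn₂ n (le_of_max_le_right hn) hbu (hn₁ n (le_of_max_le_left hn) hbu) f hf Z' hZ')

/-! ## §3. The cycle range along Ω⁺-steps: strict transform inside a cycle, the END centre -/

/-- **THE NEXT CYCLE RANGE IS THE STRICT TRANSFORM OF THE PREVIOUS ONE** along an Ω⁺-step INTO a cycle state (`P = some` next): the
replayed subscheme carried on is the strict transform (GW 13.96 (2), tree `IsReplayStep.range_hom_eq_strictTransformSet`) of the embedded
part (cycle start) or of the previous replayed subscheme (replay). [cite: CossartJannsenSaito2020, Rem. 6.29 (1)] [cite: GortzWedhorn2020, Prop. 13.96 (2)] -/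
theorem StepProjectionσ.exists_range_hom_eq_strictTransformSet_Ωplus {f : s'.W ⟶ s.W}
    (hf : StepProjectionσ (Strategy.ofStageOraclePlus ω) N ν s s' f) {Q' : Pending s'.W} (hQ' : s'.P = some Q') :
    ∃ (C : s.W.IdealSheafData) (P' : Option (Pending (blowup C))), IsCanonicalStepΩplus ω s.ln N ν s.L s.P C P' ∧
      Set.range Q'.hom.base = strictTransformSet f (C.support : Set s.W) (cycleRange N ν s) := by
  obtain ⟨C, P', hln, x', hcs, -, -, -, e, rfl⟩ := hf
  subst e
  change IsCanonicalStepΩplus ω s.ln N ν s.L s.P C P' at hcs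
  change P' = some Q' at hQ'
  refine ⟨C, P', hcs, ?_⟩
  simp only [eqToHom_refl, Category.id_comp]
  rcases hsP : s.P with _ | Q
  · rw [cycleRange_of_none hsP, treatedLabel_of_none hsP]
    rw [hsP] at hcs
    obtain ⟨j, hj, hcl, t, -, hrep⟩ := hcs
    rw [hj.csInf_eq]
    cases t with
    | nil _ =>
      obtain ⟨-, hnone⟩ := hrep
      rw [hnone] at hQ'
      exact absurd hQ' (by simp)
    | cons D t' =>
      have hrep' : IsReplayStep s.L (Scheme.hsStratum s.W N ν) j _ (CentreSeq.cons D t') C P' := hrep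
      obtain ⟨P'', hP'', hrange⟩ := hrep'.range_hom_eq_strictTransformSet
      obtain rfl : P'' = Q' := Option.some_injective _ (hP''.symm.trans hQ')
      rw [hrange, Scheme.IdealSheafData.range_subschemeι, Scheme.IdealSheafData.coe_support_vanishingIdeal]
      rfl
  · rw [cycleRange_of_some hsP]
    rw [hsP] at hcs
    obtain ⟨-, hrep⟩ := hcs
    haveI := Q.isClosedImmersion
    generalize hr : Q.rest = r at hrep
    cases r with
    | nil _ =>
      obtain ⟨-, hnone⟩ := hrep
      rw [hnone] at hQ'
      exact absurd hQ' (by simp)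
    | cons D t' =>
      have hrep' : IsReplayStep s.L (Scheme.hsStratum s.W N ν) Q.lbl Q.hom (CentreSeq.cons D t') C P' := hrep
      obtain ⟨P'', hP'', hrange⟩ := hrep'.range_hom_eq_strictTransformSet
      obtain rfl : P'' = Q' := Option.some_injective _ (hP''.symm.trans hQ')
      exact hrange

/-- **THE Ω⁺ END CENTRE IS `V(cycleRange)`** (functional stage oracle): at an Ω⁺-step into a state BETWEEN cycles the centre is the whole
treated part (a cycle of length `0`) or the image of the replayed subscheme (END rule). [cite: CossartJannsenSaito2020, Rem. 6.29 (1)] -/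
theorem support_eq_cycleRange_of_next_none_Ωplus (hωf : OracleFunctionalΩ ω)
    (hst : CanonicalNearStepσ (Strategy.ofStageOraclePlus ω) N ν s s') (hnone : s'.P = none)
    {C : s.W.IdealSheafData} {P' : Option (Pending (blowup C))} (hcs : IsCanonicalStepΩplus ω s.ln N ν s.L s.P C P') :
    (C.support : Set s.W) = cycleRange N ν s := by
  obtain ⟨C₀, P₀, hln, x', hcs₀, -, -, -, rfl⟩ := hst
  change IsCanonicalStepΩplus ω s.ln N ν s.L s.P C₀ P₀ at hcs₀
  change P₀ = none at hnone
  subst hnone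
  obtain rfl : C = C₀ := hcs.centre_unique hωf hcs₀
  clear hcs
  rcases hsP : s.P with _ | Q
  · rw [cycleRange_of_none hsP, treatedLabel_of_none hsP]
    rw [hsP] at hcs₀
    obtain ⟨j, hj, hcl, t, -, hrep⟩ := hcs₀
    rw [hj.csInf_eq]
    cases t with
    | nil _ =>
      obtain ⟨⟨hc, hC⟩, -⟩ := hrep
      rw [hC, Scheme.IdealSheafData.coe_support_vanishingIdeal]
      show Set.range _ = _
      rw [Scheme.IdealSheafData.range_subschemeι, Scheme.IdealSheafData.coe_support_vanishingIdeal]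
      rfl
    | cons D t' =>
      obtain ⟨-, φ', hφ', -, hsome⟩ := (isReplayStepPlus_cons_iff _ _ _ _ D t' C none).mp hrep
      exact absurd hsome (by simp)
  · rw [cycleRange_of_some hsP]
    rw [hsP] at hcs₀
    obtain ⟨-, hrep⟩ := hcs₀
    generalize hr : Q.rest = r at hrep
    cases r with
    | nil _ =>
      obtain ⟨⟨hc, hC⟩, -⟩ := hrep
      rw [hC, Scheme.IdealSheafData.coe_support_vanishingIdeal]
      rfl
    | cons D t' =>
      obtain ⟨-, φ', hφ', -, hsome⟩ := (isReplayStepPlus_cons_iff _ _ _ _ D t' C none).mp hrep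
      exact absurd hsome (by simp)

/-! ## §4. Lineage tracking through an Ω⁺-cycle, and row (c)Ω⁺ from (c-geo) and (c-rep) -/

/-- **LINEAGE TRACKING THROUGH AN Ω⁺-CYCLE.** Along an Ω⁺-chain with step projections `f n` and a dominating lineage `Z` of irreducible
components of the `ν`-strata whose labels equal the treated label at every state BETWEEN cycles from the stage `a` on, with `(c a).P = none`:
for every `d`, either some member `Z i`, `a ≤ i < a + d`, lies inside the centre of the step at `i`, or `Z (a + d) ⊆ cycleRange (c (a + d))`.
[cite: CossartJannsenSaito2020, Rem. 6.29 (1), (6.5)–(6.7)] [cite: GortzWedhorn2020, (13.19) p. 414, Prop. 13.96 (2)] -/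
theorem lineage_in_centre_or_subset_cycleRange_Ωplus {c : ℕ → MarkedStage.{u}} {f : ∀ n, (c (n + 1)).W ⟶ (c n).W}
    (hf : ∀ n, StepProjectionσ (Strategy.ofStageOraclePlus ω) N ν (c n) (c (n + 1)) (f n)) {Z : ∀ n, Set (c n).W}
    (hZ : ∀ n, Z n ∈ componentsIn (Scheme.hsStratum (c n).W N ν)) (hdom : ∀ n, closure ((f n).base '' Z (n + 1)) = Z n)
    {a : ℕ} (ha : (c a).P = none) (hlab : ∀ n, a ≤ n → (c n).P = none → (c n).L.label (Z n) = treatedLabel N ν (c n)) (d : ℕ) :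
    (∃ i, a ≤ i ∧ i < a + d ∧ ∃ (C : (c i).W.IdealSheafData) (P' : Option (Pending (blowup C))),
        IsCanonicalStepΩplus ω (c i).ln N ν (c i).L (c i).P C P' ∧ Z i ⊆ (C.support : Set (c i).W)) ∨
      Z (a + d) ⊆ cycleRange N ν (c (a + d)) := by
  induction d with
  | zero => exact Or.inr (subset_cycleRange_of_none ha (hZ a) (hlab a le_rfl ha))
  | succ d ih =>
    rw [← Nat.add_assoc]
    rcases ih with ⟨i, hai, hid, hC⟩ | hR
    · exact Or.inl ⟨i, hai, by omega, hC⟩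
    · rcases hP : (c (a + d + 1)).P with _ | Q'
      · exact Or.inr (subset_cycleRange_of_none hP (hZ _) (hlab _ (by omega) hP))
      · obtain ⟨C, P', hcs, hrange⟩ := (hf (a + d)).exists_range_hom_eq_strictTransformSet_Ωplus hP
        by_cases hZC : Z (a + d) ⊆ (C.support : Set (c (a + d)).W)
        · exact Or.inl ⟨a + d, by omega, by omega, C, P', hcs, hZC⟩
        · refine Or.inr ?_
          rw [cycleRange_of_some hP, hrange]
          exact (subset_strictTransformSet_of_closure_image_eq (f (a + d)) C.support.isClosed
            (componentsIn.isIrreducible (hZ _)).isPreirreducible (hdom (a + d)) hZC).trans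
            (closure_mono (Set.preimage_mono (Set.sdiff_subset_sdiff_left hR)))

/-- **ROW (c)σ FROM (c-geo)σ AND (c-rep)σ over Ω⁺ — PROVED** (functional Ω⁺-admissible stage oracle, `ν ≠ Φ^{(N)}`). Port of stub-4's
`strataLineagesFinite_of_centreIO_of_replaySettle` (steps (1)–(6): label invariant, constant lineage label `ℓ`, treated label monotone and
`≤ ℓ` hence eventually constant `= j`, late blown-up stages are cycle ends so `x_n ∈ Y_n^{(j)}`, parents of label-`j` components, Kőnig),
with the last step «the label-`j` lineage lies in the END centre» replaced by the lineage tracking of §4. [cite: CossartJannsenSaito2020, Rem. 6.29 (1), p. 105] -/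
theorem strataLineagesFiniteσ_of_centreIO_of_replaySettle_Ωplus {p : ℕ} {Q : ℕ → (ℕ → ℕ) → ∀ X : Scheme.{u}, X → Prop}
    {G : MarkedStage.{u} → Prop} (hωf : OracleFunctionalΩ ω) (hω : OracleAdmissibleΩplus ω)
    (hgeo : StrataLineageInCentreIOσ (Strategy.ofStageOraclePlus ω) p N (QNe Q) G)
    (hrep : StrataReplayBlowupsSettleσ (Strategy.ofStageOraclePlus ω) p N (QNe Q) G) :
    StrataLineagesFiniteσ (Strategy.ofStageOraclePlus ω) p N (QNe Q) G := by
  intro ν X _ x hX hQ c h0 hstep hG hnI hmov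
  rintro ⟨Z, hZ, hdom⟩
  have hν : ν ≠ iterPSum N Phi := hQ.2
  -- (1) invariants along the chain
  have hinv : ∀ n, LabelInv N ν (c n) := fun n => labelInv_chainΩplus h0 hstep n
  have hpart : ∀ n, ∀ Q', (c n).P = some Q' →
      Set.range Q'.hom.base ⊆ (c n).L.part (Scheme.hsStratum (c n).W N ν) Q'.lbl :=
    range_hom_subset_part_chainΩplus hω hν hX h0 hstep
  have hpt : ∀ n, (c n).pt ∈ Scheme.hsStratum (c n).W N ν := fun n =>
    pt_mem_hsStratum_of_reachesσ (reachesσ_chain h0 hstep n) hX.mem_stratum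
  have hne : ∀ n, (Scheme.hsStratum (c n).W N ν).Nonempty := fun n => ⟨_, hpt n⟩
  -- (2) the label of the lineage is constant
  choose f hf hfZ using hdom
  have hlab : ∀ n, (c n).L.label (Z n) = (c 0).L.label (Z 0) := by
    intro n
    induction n with
    | zero => rfl
    | succ n ih => rw [← ih, (hf n).label_eq_of_mem ((hfZ n).symm ▸ (hZ n).1), hfZ n]
  set ℓ := (c 0).L.label (Z 0) with hℓ
  -- (3) the treated label is monotone and bounded by `ℓ`, hence eventually constant `= j`
  have hmono : Monotone fun n => treatedLabel N ν (c n) :=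
    monotone_nat_of_le_succ fun n => treatedLabel_le_of_stepΩplus (hinv n) (hstep n) (hne (n + 1))
  have hbdd : ∀ n, treatedLabel N ν (c n) ≤ ℓ := fun n => (hlab n) ▸ treatedLabel_le_label (hinv n) (hZ n).1
  obtain ⟨j, n₂, hj⟩ :=
    Summit.ResolutionOfSingularities.ResolutionOfSingularities.Cruxes.SigmaMaxModifications.MovingCompactnessLine.eventually_const_of_monotone_of_bounded
      hmono hbdd
  -- (4)+(5) from some stage on, blow-ups of the chain point are cycle ends, hence `x_n ∈ Y_n^{(j)}` there
  obtain ⟨n₁, hn₁⟩ := hrep ν X x hX hQ c h0 hstep hG hnI hmov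
  have hjyear : ∀ n, n₂ ≤ n → j ≤ (c n).L.year := fun n hn => (hj n hn) ▸ treatedLabel_le_year (hinv n) (hne n)
  let T : ∀ n, Set (Set (c n).W) := fun n => {W | W ∈ componentsThrough N ν (c n) ∧ (c n).L.label W = j}
  set n₃ := max n₁ n₂ + 1 with hn₃
  have hparent : ∀ n, n₃ ≤ n → ∀ W' ∈ T (n + 1), closure ((f n).base '' W') ∈ T n := by
    intro n hn W' ⟨hW', hlW'⟩
    have hne' : (c (n + 1)).L.label W' ≠ (c n).L.year + 1 := by
      rw [hlW']
      have := hjyear n (by omega)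
      omega
    have hmem := (hf n).mem_componentsIn_of_label_ne hne'
    exact ⟨(hf n).closure_image_mem_componentsThrough hW' hmem, ((hf n).label_eq_of_mem hmem) ▸ hlW'⟩
  have hT_of_blownUp : ∀ n, n₃ ≤ n → (c n).IsBlownUpσ (Strategy.ofStageOraclePlus ω) N ν → (T n).Nonempty := by
    intro n hn hbu
    obtain ⟨C, P', hcs, hptC⟩ := hbu
    have hnone : (c (n + 1)).P = none := hn₁ n (by omega) ⟨C, P', hcs, hptC⟩
    have hsupp := support_subset_part_of_next_none_Ωplus hωf (hpart n) (hstep n) hnone hcs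
    have hptj := hsupp hptC
    rw [hj n (by omega)] at hptj
    obtain ⟨W, hW, hlW, hxW⟩ := ((c n).L.mem_part_iff _ j _).mp hptj
    exact ⟨W, ⟨hW, hxW⟩, hlW⟩
  have hdesc : ∀ d n, n₃ ≤ n → (T (n + d)).Nonempty → (T n).Nonempty := by
    intro d
    induction d with
    | zero => exact fun n _ h => h
    | succ d ih =>
      intro n hn h
      obtain ⟨W', hW'⟩ := h
      exact ih n hn ⟨_, hparent (n + d) (by omega) W' hW'⟩
  have hTne : ∀ n, n₃ ≤ n → (T n).Nonempty := by
    intro n hn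
    obtain ⟨m, hnm, hbu⟩ := hmov n
    obtain ⟨d, rfl⟩ := Nat.exists_eq_add_of_le hnm
    exact hdesc d n hn (hT_of_blownUp (n + d) (by omega) hbu)
  -- (6) Kőnig on the label-`j` components through the chain points of the tail from `n₃`
  let c' : ℕ → MarkedStage.{u} := fun n => c (n₃ + n)
  have hN : ∀ n, IsNoetherian (c' n).W := fun n =>
    isNoetherian_of_reachesσ_init hX (reachesσ_chain h0 hstep (n₃ + n))
  let F : ℕ → Type u := fun n => ↥(T (n₃ + n))
  haveI : ∀ n, Finite (F n) := fun n => by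
    haveI := hN n
    exact ((componentsThrough_finite (N := N) (ν := ν) (c' n)).subset fun _ h => h.1).to_subtype
  haveI : ∀ n, Nonempty (F n) := fun n => (hTne (n₃ + n) (Nat.le_add_right _ _)).to_subtype
  obtain ⟨u, hu⟩ := exists_section_of_finite_nonempty (F := F) fun n W' =>
    ⟨closure ((f (n₃ + n)).base '' W'.1), hparent (n₃ + n) (Nat.le_add_right _ _) W'.1 W'.2⟩
  -- the section is a dominating lineage of label `j` through the chain points; it meets a centre in every late blown-up cycle
  have hstep' : ∀ n, CanonicalNearStepσ (Strategy.ofStageOraclePlus ω) N ν (c' n) (c' (n + 1)) := fun n => hstep (n₃ + n)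
  have hf' : ∀ n, StepProjectionσ (Strategy.ofStageOraclePlus ω) N ν (c' n) (c' (n + 1)) (f (n₃ + n)) := fun n => hf (n₃ + n)
  have hmov' : ∀ n, ∃ m, n ≤ m ∧ (c' m).IsBlownUpσ (Strategy.ofStageOraclePlus ω) N ν := io_shift hmov n₃
  refine hgeo ν X x hX hQ c' (reachesσ_chain h0 hstep n₃) hstep' (fun n => hG _) (fun n => hnI _) hmov'
    ⟨fun n => (u n).1, fun n => (u n).2.1, fun n => ⟨f (n₃ + n), hf' n, congrArg Subtype.val (hu n)⟩, fun n => ?_⟩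
  -- a state between cycles `a ≥ n`, then a blown-up stage `m ≥ a`: track the lineage from `a` to `m`
  obtain ⟨a₀, hna₀, ha⟩ := exists_next_none_Ωplus hstep' n
  obtain ⟨m, ham, hbu⟩ := hmov' (a₀ + 1)
  obtain ⟨d, rfl⟩ := Nat.exists_eq_add_of_le ham
  have hlabu : ∀ i, a₀ + 1 ≤ i → (c' i).P = none → (c' i).L.label (u i).1 = treatedLabel N ν (c' i) :=
    fun i _ _ => ((u i).2.2).trans (hj (n₃ + i) (by omega)).symm
  rcases lineage_in_centre_or_subset_cycleRange_Ωplus hf' (fun n => (u n).2.1.1) (fun n => congrArg Subtype.val (hu n))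
      ha hlabu d with ⟨i, hai, -, C, P', hcs, hZC⟩ | hR
  · exact ⟨i, by omega, C, P', hcs, hZC⟩
  · obtain ⟨C, P', hcs, hptC⟩ := hbu
    have hnone : (c' (a₀ + 1 + d + 1)).P = none := hn₁ (n₃ + (a₀ + 1 + d)) (by omega) ⟨C, P', hcs, hptC⟩
    refine ⟨a₀ + 1 + d, by omega, C, P', hcs, ?_⟩
    rw [support_eq_cycleRange_of_next_none_Ωplus hωf (hstep' _) hnone hcs]
    exact hR

/-! ## §5. The strata-half over Ω⁺ assembled from its kernel rows -/

/-- **THE STRATA-HALF OVER Ω⁺ ASSEMBLED FROM ITS KERNELS at `QNe Q` — PROVED**: for a functional Ω⁺-admissible stage oracle, the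
cycle-end births row (b-end)σ, the dimension-two kernel (c-geo)σ and the replay row (c-rep)σ (all at `QNe Q`) give «no moving, never-isolated
`G`-chain of Ω⁺-steps from a `QNe Q`-maximal origin» (brick 1's Kőnig reduction). [cite: CossartJannsenSaito2020, Rem. 6.29 (1), Thm. 6.35, Prop. 6.31] -/
theorem maxOriginNoMovingNearChainAtQσ_notIso_of_kernels_Ωplus {p : ℕ} {Q : ℕ → (ℕ → ℕ) → ∀ X : Scheme.{u}, X → Prop}
    {G : MarkedStage.{u} → Prop} (hωf : OracleFunctionalΩ ω) (hω : OracleAdmissibleΩplus ω)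
    (hend : StrataCycleEndBirthsSettleσ (Strategy.ofStageOraclePlus ω) p N (QNe Q) G)
    (hgeo : StrataLineageInCentreIOσ (Strategy.ofStageOraclePlus ω) p N (QNe Q) G)
    (hrep : StrataReplayBlowupsSettleσ (Strategy.ofStageOraclePlus ω) p N (QNe Q) G) :
    MaxOriginNoMovingNearChainAtQσ (Strategy.ofStageOraclePlus ω) p N (QNe Q) fun s => G s ∧ ¬ Iso N s :=
  maxOriginNoMovingNearChainAtQσ_notIso_of_lineages (strataBirthsSettleσ_of_replaySettle_of_cycleEnd_Ωplus hω hrep hend)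
    (strataLineagesFiniteσ_of_centreIO_of_replaySettle_Ωplus hωf hω hgeo hrep)

/-- **… and at `Q` itself, given the non-degeneracy row (D)σ.** [cite: CossartJannsenSaito2020, Rem. 6.29 (1), Thm. 6.35, Prop. 6.31] -/
theorem maxOriginNoMovingNearChainAtQσ_of_kernels_Ωplus {p : ℕ} {Q : ℕ → (ℕ → ℕ) → ∀ X : Scheme.{u}, X → Prop}
    {G : MarkedStage.{u} → Prop} (hωf : OracleFunctionalΩ ω) (hω : OracleAdmissibleΩplus ω)
    (hD : MaxOriginMovingNondegenerateσ (Strategy.ofStageOraclePlus ω) p N)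
    (hend : StrataCycleEndBirthsSettleσ (Strategy.ofStageOraclePlus ω) p N (QNe Q) G)
    (hgeo : StrataLineageInCentreIOσ (Strategy.ofStageOraclePlus ω) p N (QNe Q) G)
    (hrep : StrataReplayBlowupsSettleσ (Strategy.ofStageOraclePlus ω) p N (QNe Q) G) :
    MaxOriginNoMovingNearChainAtQσ (Strategy.ofStageOraclePlus ω) p N Q fun s => G s ∧ ¬ Iso N s :=
  maxOriginNoMovingNearChainAtQσ_of_qNe hD (maxOriginNoMovingNearChainAtQσ_notIso_of_kernels_Ωplus hωf hω hend hgeo hrep)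

end Omega

end Summit.ResolutionOfSingularities.ResolutionOfSingularities.Theorems.SigmaMaxModificationsCorridor3.Sigma

end
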